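import Literature.Geometry.Lorentzian.HarmonicallyFlatGradientProofs
import Literature.MeasureTheory.Hausdorff.SphereArea
import HarnessLib

/-!
# Bray's total mass `2ab` is the ADM energy: discharge of
# `Literature.Geometry.Lorentzian.Bray2001_harmonicallyFlatMass_hasADMEnergy`

Companion ("Proofs") file of `Literature/Geometry/Lorentzian/HarmonicallyFlat.lean`, which
vendors as the named fact `Bray2001_harmonicallyFlatMass_hasADMEnergy` the remark of Bray,
J. Differential Geom. 59 (2001) 177–267 (arXiv:math/9911173), §2, following Def. 2: *"this
definition [total mass `= 2ab` in the expansion (10) `𝒰₀ = a + b/|x| + O(1/|x|²)` of the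
conformal factor of a harmonically flat end] agrees with the standard definition of the total
mass of an asymptotically flat manifold (defined in equation (225)) in the case that the manifold
is harmonically flat at infinity"*, (225) being the ADM flux limit
`(16π)⁻¹ lim_σ ∮_{S_σ} Σ_{ij} (g_{ij,i} - g_{ii,j}) νⱼ dμ` with `dμ` the coordinate area element
— in the tree `AFEnd.HasADMEnergy` (`AsymptoticFlatness.lean`, flux against Mathlib's Euclidean
Hausdorff measure `μHE[2]` on coordinate spheres), for an end whose conformal factor tends to `1`
in its chart (`a = 1`). This file PROVES it (`Bray2001_harmonicallyFlatMass_hasADMEnergy_holds`):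

* `AFEnd.IsHarmonicallyFlatWith.partialH_eq`, `….admIntegrand_eq`, `….admEnergyFlux_eq` — in the
  chart of a harmonically flat end `h_ij = U⁴ δ_ij` beyond `R₁`, so `∂ₗ h_ij = δ_ij 4U³ ∂ₗU` and the
  ADM integrand is `Σ_{ij} (∂ⱼh_ij - ∂ᵢh_jj) xᵢ/r = -8 U³ DU(x)x / r`; hence
  `E(r) = (16π)⁻¹ ∮_{S_r} -8 U³ DU(x)x / r dμHE[2]` for `r > R₁`;
* `AFEnd.IsHarmonicallyFlatWith.hasADMEnergy` — if moreover `U = 1 + b/|x| + O(|x|⁻²)`, then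
  `E(r) → 2b`: by the gradient expansion `DU(x)x = -b/r + O(r⁻²)` with the same `b`
  (`exists_hasHarmonicExpansion_fderiv`, `HarmonicallyFlatGradientProofs.lean`, and uniqueness of
  the expansion coefficients) the integrand is `8b/r² + O(r⁻³)` uniformly on `S_r`
  (`abs_cube_mul_add_le`), and `μHE[2] (S_r) = 4π r²` (`euclideanHausdorffMeasure_sphere_fin_three`,
  `Literature/MeasureTheory/Hausdorff/SphereArea.lean`) gives `E(r) = 2b + O(1/r)`;
* `Bray2001_harmonicallyFlatMass_hasADMEnergy_holds` — the discharge: the second conformal factor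
  tending to `1` forces `a = 1` (`IsHarmonicallyFlatWith.factor_eventuallyEq`), so `m = 2ab = 2b`.

Nothing is defined and no fact is introduced; the statement proved is the one vendored in
`HarmonicallyFlat.lean`, unchanged.

## References

* H. L. Bray, *Proof of the Riemannian Penrose inequality using the positive mass theorem*,
  J. Differential Geom. 59 (2001) 177–267, §2, (9)–(10), Def. 2 and the remark following it;
  §13, (225).
* R. Arnowitt, S. Deser, C. W. Misner (1962); R. Bartnik, CPAM 39 (1986), (4.2) (the ADM flux).
-/

noncomputable section

open Set Filter Asymptotics Bornology Metric MeasureTheory Topology InnerProductSpace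
open scoped Real ContDiff RealInnerProductSpace Manifold ENNReal

namespace Literature.Geometry.Lorentzian

open Literature.MeasureTheory.Hausdorff

/-! ### An elementary estimate -/

/-- The arithmetic of the flux integrand: if `|t| ≤ K₂ ρ`, `|t| ≤ 1` and `|E| ≤ C ρ²` (`ρ > 0`),
then `|(1 + t)³ (E - β ρ) + β ρ| ≤ (8 C + 7 |β| K₂) ρ²` (expand
`(1+t)³(E - βρ) + βρ = (1+t)³ E - βρ t (3 + 3t + t²)`). [folklore] -/
theorem abs_cube_mul_add_le {t E β ρ C K₂ : ℝ} (hρ : 0 < ρ) (ht : |t| ≤ K₂ * ρ) (ht1 : |t| ≤ 1)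
    (hE : |E| ≤ C * ρ ^ 2) :
    |(1 + t) ^ 3 * (E - β * ρ) + β * ρ| ≤ (8 * C + 7 * |β| * K₂) * ρ ^ 2 := by
  have hid : (1 + t) ^ 3 * (E - β * ρ) + β * ρ =
      (1 + t) ^ 3 * E - β * ρ * (t * (3 + 3 * t + t ^ 2)) := by ring
  rw [hid]
  have h1 : |(1 + t) ^ 3 * E| ≤ 8 * (C * ρ ^ 2) := by
    rw [abs_mul, abs_pow]
    have h1t : |1 + t| ≤ 2 := by
      have := abs_add_le (1 : ℝ) t
      rw [abs_one] at this
      linarith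
    have h8 : |1 + t| ^ 3 ≤ 2 ^ 3 := pow_le_pow_left₀ (abs_nonneg _) h1t 3
    calc |1 + t| ^ 3 * |E| ≤ 2 ^ 3 * (C * ρ ^ 2) :=
          mul_le_mul h8 hE (abs_nonneg _) (by positivity)
      _ = 8 * (C * ρ ^ 2) := by norm_num
  have h2 : |β * ρ * (t * (3 + 3 * t + t ^ 2))| ≤ |β| * ρ * (K₂ * ρ * 7) := by
    rw [abs_mul, abs_mul, abs_mul, abs_of_pos hρ]
    have h7 : |3 + 3 * t + t ^ 2| ≤ 7 := by
      rw [abs_le]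
      have := abs_le.1 ht1
      constructor <;> nlinarith
    have hK : 0 ≤ K₂ * ρ := (abs_nonneg t).trans ht
    calc |β| * ρ * (|t| * |3 + 3 * t + t ^ 2|) ≤ |β| * ρ * (K₂ * ρ * 7) := by
          refine mul_le_mul_of_nonneg_left ?_ (by positivity)
          exact mul_le_mul ht h7 (abs_nonneg _) hK
      _ = |β| * ρ * (K₂ * ρ * 7) := rfl
  calc |(1 + t) ^ 3 * E - β * ρ * (t * (3 + 3 * t + t ^ 2))|
      ≤ |(1 + t) ^ 3 * E| + |β * ρ * (t * (3 + 3 * t + t ^ 2))| := abs_sub _ _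
    _ ≤ 8 * (C * ρ ^ 2) + |β| * ρ * (K₂ * ρ * 7) := add_le_add h1 h2
    _ = (8 * C + 7 * |β| * K₂) * ρ ^ 2 := by ring

/-! ### The ADM flux of a harmonically flat end -/

section Flux

variable {X : Type*} [TopologicalSpace X] [ChartedSpace E3 X] [IsManifold (𝓡 3) ∞ X]
  {e : AFEnd X} {D : InitialDataSet (𝓡 3) X} [D.metric.HasLeviCivita] {R₁ : ℝ} {U : E3 → ℝ}

/-- **Chart components of a harmonically flat end**: `h_ij(y) = U(y)⁴ δ_ij` for `R₁ < |y|`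
(Bray 2001, (9), `g₀ = 𝒰₀⁴ g_flat`, evaluated on the coordinate vectors).
[cite: BrayRPI2001, §2 (9)] -/
theorem AFEnd.IsHarmonicallyFlatWith.hCoeff_single_single (hU : e.IsHarmonicallyFlatWith D R₁ U)
    {y : E3} (hy : R₁ < ‖y‖) (i j : Fin 3) :
    AFEnd.hCoeff e D y (EuclideanSpace.single i 1) (EuclideanSpace.single j 1) =
      U y ^ 4 * (if i = j then 1 else 0) := by
  rw [hU.hCoeff_eq hy]
  change U y ^ 4 * ⟪EuclideanSpace.single i (1 : ℝ), EuclideanSpace.single j (1 : ℝ)⟫ = _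
  rw [EuclideanSpace.inner_single_left]
  simp [PiLp.single_apply]

/-- **Coordinate derivatives of the chart components**: `∂ₗ h_ij(x) = δ_ij · 4 U(x)³ ∂ₗU(x)` for
`R₁ < |x|` (the components agree with `U⁴ δ_ij` near `x`, and `U` is `C²` there, being
harmonic). Bray 2001, §2, (9). [cite: BrayRPI2001, §2 (9)] -/
theorem AFEnd.IsHarmonicallyFlatWith.partialH_eq (hU : e.IsHarmonicallyFlatWith D R₁ U)
    {x : E3} (hx : R₁ < ‖x‖) (l i j : Fin 3) :
    AFEnd.partialH e D l i j x =
      (if i = j then 1 else 0) * (4 * U x ^ 3 * fderiv ℝ U x (EuclideanSpace.single l 1)) := by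
  have hdiff : DifferentiableAt ℝ U x := (hU.harmonicOnNhd x hx).1.differentiableAt two_ne_zero
  have hev : (fun y ↦ AFEnd.hCoeff e D y (EuclideanSpace.single i 1) (EuclideanSpace.single j 1))
      =ᶠ[𝓝 x] fun y ↦ U y ^ 4 * (if i = j then 1 else 0) := by
    filter_upwards [(isOpen_lt continuous_const continuous_norm).mem_nhds hx] with y hy
    exact hU.hCoeff_single_single hy i j
  unfold AFEnd.partialH
  rw [hev.fderiv_eq, ((hdiff.hasFDerivAt.pow 4).mul_const _).fderiv]
  by_cases hij : i = j
  · simp [hij]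
  · simp [hij]

/-- **The ADM integrand of a harmonically flat end**: for `R₁ < |x|`,
`Σᵢⱼ (∂ⱼh_ij − ∂ᵢh_jj)(x) xᵢ/r = −8 U(x)³ DU(x)x / r` (`Σᵢⱼ δ_ij gⱼ xᵢ − Σᵢⱼ gᵢ xᵢ = −2 Σᵢ gᵢ xᵢ`
with `gₗ = 4U³∂ₗU`, and `Σᵢ xᵢ ∂ᵢU = DU(x)x`). Bray 2001, §13, (225) for the metric (9).
[cite: BrayRPI2001, §13 (225)] -/
theorem AFEnd.IsHarmonicallyFlatWith.admIntegrand_eq (hU : e.IsHarmonicallyFlatWith D R₁ U)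
    {x : E3} (hx : R₁ < ‖x‖) (r : ℝ) :
    ∑ i : Fin 3, ∑ j : Fin 3,
      (AFEnd.partialH e D j i j x - AFEnd.partialH e D i j j x) * x i / r =
      -8 * U x ^ 3 * fderiv ℝ U x x / r := by
  simp only [hU.partialH_eq hx]
  have hsum : x = ∑ i : Fin 3, x i • EuclideanSpace.single i (1 : ℝ) := by
    simpa using ((EuclideanSpace.basisFun (Fin 3) ℝ).sum_repr x).symm
  have hxr : fderiv ℝ U x x = ∑ i : Fin 3, x i * fderiv ℝ U x (EuclideanSpace.single i 1) := by
    rw [congrArg (fderiv ℝ U x) hsum, map_sum]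
    simp
  rw [hxr]
  simp only [Fin.sum_univ_three, Fin.isValue]
  simp
  ring

/-- **The ADM flux of a harmonically flat end**: for `r > R₁`,
`E(r) = (16π)⁻¹ ∮_{|x| = r} −8 U³ DU(x)x / r dμHE[2]`. Bray 2001, §13, (225) for the metric (9).
[cite: BrayRPI2001, §13 (225)] -/
theorem AFEnd.IsHarmonicallyFlatWith.admEnergyFlux_eq (hU : e.IsHarmonicallyFlatWith D R₁ U)
    {r : ℝ} (hr : R₁ < r) :
    AFEnd.admEnergyFlux e D r = (16 * Real.pi)⁻¹ *
      ∫ x in sphere (0 : E3) r, -8 * U x ^ 3 * fderiv ℝ U x x / r ∂(μHE[2] : Measure E3) := by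
  unfold AFEnd.admEnergyFlux
  congr 1
  refine setIntegral_congr_fun isClosed_sphere.measurableSet fun x hx ↦ ?_
  rw [mem_sphere_zero_iff_norm] at hx
  exact hU.admIntegrand_eq (by rw [hx]; exact hr) r

/-- **The ADM energy of a harmonically flat end whose conformal factor has the expansion
`U = 1 + b/|x| + O(|x|⁻²)` is `2b`** (Bray 2001, §2, the remark after Def. 2, with `a = 1`):
the fluxes `E(r) = (16π)⁻¹ ∮_{S_r} −8U³ DU(x)x/r` satisfy `|E(r) − 2b| ≤ K/r` for large `r`,
since `DU(x)x = −b/r + O(r⁻²)` (gradient expansion, same `b` by uniqueness of the coefficients),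
`U = 1 + O(1/r)`, and `μHE[2](S_r) = 4πr²`. [cite: BrayRPI2001, §2 Def. 2 and §13 (225)] -/
theorem AFEnd.IsHarmonicallyFlatWith.hasADMEnergy (hU : e.IsHarmonicallyFlatWith D R₁ U) {b : ℝ}
    (hab : HasHarmonicExpansion U 1 b) : e.HasADMEnergy D (2 * b) := by
  -- the gradient expansion, with the same `b`
  obtain ⟨b', C, T, hb', hT, hgrad⟩ :=
    exists_hasHarmonicExpansion_fderiv R₁ U 1 hU.harmonicOnNhd hab.tendsto
  obtain ⟨-, hbb⟩ := hab.unique hb' EventuallyEq.rfl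
  subst hbb
  -- the zeroth-order bound
  obtain ⟨C₂, hC₂pos, hC₂⟩ := hab.exists_pos
  rw [IsBigOWith_def] at hC₂
  obtain ⟨R₂, -, hR₂⟩ := Filter.hasBasis_cobounded_norm.eventually_iff.1 hC₂
  have hC0 : 0 ≤ C := by
    -- from the bound at a far point with `w = 0`... use `x` with `‖x‖ = T`-free argument:
    obtain ⟨x, hx⟩ : ∃ x : E3, T ≤ ‖x‖ := by
      obtain ⟨x, hx⟩ := (NormedSpace.sphere_nonempty (E := E3) (x := 0) (r := T)).2 hT.le
      exact ⟨x, by rw [mem_sphere_zero_iff_norm] at hx; rw [hx]⟩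
    have h := hgrad x hx x
    have hx0 : 0 < ‖x‖ := hT.trans_le hx
    have : 0 ≤ C * ‖x‖ / ‖x‖ ^ 3 := (abs_nonneg _).trans h
    have h3 : 0 < ‖x‖ / ‖x‖ ^ 3 := by positivity
    rw [mul_div_assoc] at this
    exact nonneg_of_mul_nonneg_left this h3
  -- constants
  set K₂ : ℝ := |b| + C₂ with hK₂
  set M : ℝ := 8 * (8 * C + 7 * |b| * K₂) with hM
  have hM0 : 0 ≤ M := by positivity
  set r₀ : ℝ := max (max T R₂) (max (R₁ + 1) (K₂ + 1)) with hr₀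
  -- pointwise estimate of the integrand on far spheres
  have hpt : ∀ r : ℝ, r₀ ≤ r → ∀ x ∈ sphere (0 : E3) r,
      |-8 * U x ^ 3 * fderiv ℝ U x x / r - 8 * b / r ^ 2| ≤ M / r ^ 3 := by
    intro r hr x hx
    rw [mem_sphere_zero_iff_norm] at hx
    have hrT : T ≤ r := le_trans (le_trans (le_max_left _ _) (le_max_left _ _)) hr
    have hrR₂ : R₂ ≤ r := le_trans (le_trans (le_max_right _ _) (le_max_left _ _)) hr
    have hrK : K₂ + 1 ≤ r := le_trans (le_trans (le_max_right _ _) (le_max_right _ _)) hr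
    have hK0 : 0 ≤ K₂ := by positivity
    have hr0 : 0 < r := by linarith
    have hr1 : 1 ≤ r := by linarith
    set ρ : ℝ := r⁻¹ with hρ
    have hρ0 : 0 < ρ := inv_pos.2 hr0
    -- `E = DU(x)x + b/r`, `|E| ≤ C/r²`
    have hE : |fderiv ℝ U x x + b * ρ| ≤ C * ρ ^ 2 := by
      have h := hgrad x (by rw [hx]; exact hrT) x
      rw [real_inner_self_eq_norm_sq, hx] at h
      have e1 : b * r ^ 2 / r ^ 3 = b * ρ := by rw [hρ]; field_simp
      have e2 : C * r / r ^ 3 = C * ρ ^ 2 := by rw [hρ]; field_simp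
      rwa [e1, e2] at h
    -- `t = U x - 1`, `|t| ≤ K₂/r ≤ 1`
    have ht : |U x - 1| ≤ K₂ * ρ := by
      have h := hR₂ (show R₂ ≤ ‖x‖ by rw [hx]; exact hrR₂)
      rw [hx, Real.norm_eq_abs, Real.norm_of_nonneg (Real.rpow_nonneg hr0.le _),
        Real.rpow_neg hr0.le, Real.rpow_two] at h
      -- `h : |U x - (1 + b * r⁻¹)| ≤ C₂ * (r ^ 2)⁻¹`
      have h2 : |U x - 1| ≤ |b| * ρ + C₂ * ρ ^ 2 := by
        have := abs_add_le (U x - (1 + b * r⁻¹)) (b * r⁻¹)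
        rw [show U x - (1 + b * r⁻¹) + b * r⁻¹ = U x - 1 by ring, abs_mul,
          abs_of_pos (inv_pos.2 hr0)] at this
        have e3 : (r ^ 2)⁻¹ = ρ ^ 2 := by rw [hρ, inv_pow]
        rw [e3] at h
        linarith
      have hρ1 : ρ ≤ 1 := by rw [hρ]; exact inv_le_one_of_one_le₀ hr1
      have hρ2 : ρ ^ 2 ≤ ρ := by nlinarith
      have : C₂ * ρ ^ 2 ≤ C₂ * ρ := mul_le_mul_of_nonneg_left hρ2 hC₂pos.le
      rw [hK₂]
      nlinarith
    have ht1 : |U x - 1| ≤ 1 := by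
      refine ht.trans ?_
      rw [hρ]
      rw [mul_inv_le_iff₀ hr0]
      linarith
    -- the estimate
    have key := abs_cube_mul_add_le (β := b) hρ0 ht ht1 hE
    have hid : -8 * U x ^ 3 * fderiv ℝ U x x / r - 8 * b / r ^ 2 =
        -8 * ρ * ((1 + (U x - 1)) ^ 3 * (fderiv ℝ U x x + b * ρ - b * ρ) + b * ρ) := by
      rw [hρ]
      field_simp
      ring
    rw [hid, abs_mul, abs_mul, abs_of_pos hρ0, show |(-8 : ℝ)| = 8 by norm_num]
    calc 8 * ρ * |(1 + (U x - 1)) ^ 3 * (fderiv ℝ U x x + b * ρ - b * ρ) + b * ρ|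
        ≤ 8 * ρ * ((8 * C + 7 * |b| * K₂) * ρ ^ 2) :=
          mul_le_mul_of_nonneg_left key (by positivity)
      _ = M / r ^ 3 := by rw [hM, hρ]; field_simp
  -- the flux estimate
  have hflux : ∀ r : ℝ, r₀ ≤ r → |AFEnd.admEnergyFlux e D r - 2 * b| ≤ M / 4 / r := by
    intro r hr
    have hrR₁ : R₁ < r := by
      have : R₁ + 1 ≤ r := le_trans (le_trans (le_max_left _ _) (le_max_right _ _)) hr
      linarith
    have hrK : K₂ + 1 ≤ r := le_trans (le_trans (le_max_right _ _) (le_max_right _ _)) hr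
    have hK0 : 0 ≤ K₂ := by positivity
    have hr0 : 0 < r := by linarith
    set μ : Measure E3 := μHE[2] with hμ
    set S : Set E3 := sphere 0 r with hS
    set F : E3 → ℝ := fun x ↦ -8 * U x ^ 3 * fderiv ℝ U x x / r with hF
    have hμS : μ S = ENNReal.ofReal (4 * Real.pi * r ^ 2) :=
      euclideanHausdorffMeasure_sphere_fin_three hr0
    have hμS' : μ S < ⊤ := by rw [hμS]; exact ENNReal.ofReal_lt_top
    have hμSr : μ.real S = 4 * Real.pi * r ^ 2 := by
      rw [measureReal_def, hμS, ENNReal.toReal_ofReal (by positivity)]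
    -- continuity of the integrand on the sphere
    have hO : IsOpen {x : E3 | R₁ < ‖x‖} := isOpen_lt continuous_const continuous_norm
    have hSO : S ⊆ {x : E3 | R₁ < ‖x‖} := fun x hx ↦ by
      rw [hS, mem_sphere_zero_iff_norm] at hx
      show R₁ < ‖x‖
      rw [hx]; exact hrR₁
    have hUc : ContDiffOn ℝ 2 U {x : E3 | R₁ < ‖x‖} := hU.harmonicOnNhd.contDiffOn
    have hFc : ContinuousOn F S := by
      have h1 : ContinuousOn U S := hUc.continuousOn.mono hSO
      have h2 : ContinuousOn (fun x ↦ fderiv ℝ U x x) S :=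
        ((hUc.continuousOn_fderiv_of_isOpen hO (by norm_num)).mono hSO).clm_apply
          continuousOn_id
      exact ((continuousOn_const.mul (h1.pow 3)).mul h2).div_const _
    have hFm : AEStronglyMeasurable F (μ.restrict S) :=
      hFc.aestronglyMeasurable isClosed_sphere.measurableSet
    have hbd : ∀ x ∈ S, ‖F x - 8 * b / r ^ 2‖ ≤ M / r ^ 3 := fun x hx ↦ by
      rw [Real.norm_eq_abs]; exact hpt r hr x hx
    have hFint : IntegrableOn F S μ := by
      refine IntegrableOn.of_bound hμS' hFm (|8 * b / r ^ 2| + M / r ^ 3) ?_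
      rw [ae_restrict_iff' isClosed_sphere.measurableSet]
      refine Eventually.of_forall fun x hx ↦ ?_
      have h := hbd x hx
      rw [Real.norm_eq_abs] at h ⊢
      have := abs_sub_abs_le_abs_sub (F x) (8 * b / r ^ 2)
      linarith
    have hcint : IntegrableOn (fun _ : E3 ↦ 8 * b / r ^ 2) S μ := integrableOn_const hμS'.ne
    -- split the integral
    have hsplit : ∫ x in S, F x ∂μ = (∫ x in S, (F x - 8 * b / r ^ 2) ∂μ) + 32 * Real.pi * b := by
      rw [integral_sub hFint hcint, setIntegral_const, hμSr]
      have h32 : (4 * Real.pi * r ^ 2) • (8 * b / r ^ 2) = 32 * Real.pi * b := by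
        rw [smul_eq_mul]
        field_simp
        ring
      rw [h32]
      ring
    have herr : ‖∫ x in S, (F x - 8 * b / r ^ 2) ∂μ‖ ≤ M / r ^ 3 * (4 * Real.pi * r ^ 2) := by
      rw [← hμSr]
      exact norm_setIntegral_le_of_norm_le_const hμS' hbd
    rw [hU.admEnergyFlux_eq hrR₁]
    change |(16 * Real.pi)⁻¹ * ∫ x in S, F x ∂μ - 2 * b| ≤ M / 4 / r
    rw [hsplit]
    set I : ℝ := ∫ x in S, (F x - 8 * b / r ^ 2) ∂μ with hI
    have hI' : (16 * Real.pi)⁻¹ * (I + 32 * Real.pi * b) - 2 * b = (16 * Real.pi)⁻¹ * I := by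
      field_simp
      ring
    rw [hI', abs_mul, abs_of_pos (by positivity)]
    rw [Real.norm_eq_abs] at herr
    calc (16 * Real.pi)⁻¹ * |I|
        ≤ (16 * Real.pi)⁻¹ * (M / r ^ 3 * (4 * Real.pi * r ^ 2)) :=
          mul_le_mul_of_nonneg_left herr (by positivity)
      _ = M / 4 / r := by
          field_simp
          ring
  -- conclusion
  rw [AFEnd.HasADMEnergy]
  refine tendsto_sub_nhds_zero_iff.1 (squeeze_zero_norm' ?_
    (tendsto_const_nhds.div_atTop tendsto_id : Tendsto (fun r : ℝ ↦ M / 4 / r) atTop (𝓝 0)))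
  filter_upwards [eventually_ge_atTop r₀] with r hr
  rw [Real.norm_eq_abs]
  exact hflux r hr

end Flux

/-! ### The discharge -/

/-- **Bray's total mass `2ab` (Def. 2) is the ADM energy (225)** — discharge of the named fact
`Bray2001_harmonicallyFlatMass_hasADMEnergy`: if the end `e` is harmonically flat with total mass
`m = 2ab` and (some, hence every) conformal factor tends to `1` in its chart, then the ADM energy
fluxes converge to `m`. The two conformal factors agree near infinity
(`IsHarmonicallyFlatWith.factor_eventuallyEq`), so `a = 1` and `m = 2b`, and
`IsHarmonicallyFlatWith.hasADMEnergy` applies. Bray, J. Differential Geom. 59 (2001), §2, the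
remark after Def. 2; §13, (225). [cite: BrayRPI2001, §2 Def. 2 and §13 (225)] -/
theorem Bray2001_harmonicallyFlatMass_hasADMEnergy_holds :
    Bray2001_harmonicallyFlatMass_hasADMEnergy := by
  intro X _ _ _ D _ e m hm hU1
  obtain ⟨R₁, U, a, b, hU, hab, rfl⟩ := hm
  obtain ⟨R₂, U', hU', hU'1⟩ := hU1
  have hUt : Tendsto U (cobounded E3) (𝓝 1) := hU'1.congr' (hU.factor_eventuallyEq hU').symm
  have ha : a = 1 := tendsto_nhds_unique hab.tendsto hUt
  subst ha
  rw [mul_one]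
  exact hU.hasADMEnergy hab

end Literature.Geometry.Lorentzian

end
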